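import Literature.NumberTheory.Automorphic.BianchiCuspCoordinates
import HarnessLib

/-!
# The stabiliser of a cusp of a Bianchi group acts discretely on the horizontal coordinate

Topic `NumberTheory/Automorphic`; namespace `Literature.NumberTheory.Automorphic`, grouping
sub-namespace `BianchiCusp`.  Theorems only; sequel of `BianchiCuspCoordinates`.

Let `u ≠ 0` be an integral vector of the imaginary quadratic field `K`, `g_u = (a c; b d)` its
cusp matrix and `w_u` the horizontal coordinate.  An element `π ∈ Γ = GL₂(𝓞_K)` FIXING THE
CUSP `u` (`π u = μ u`, `μ ∈ K`; `(π u)₀ u₁ = (π u)₁ u₀`) is conjugated by `g_u` into an upper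
triangular matrix `m = g_u⁻¹ σ(π) g_u = (σμ m₀₁; 0 m₁₁)` with `|σμ| = |m₁₁| = 1`
(`norm_eq_one_of_mulVec_eq_smul`: `N𝔞_{πu} = N𝔞_u`), and it acts on the horizontal coordinate by
a Euclidean motion `w ↦ ζ w + t`, `|ζ| = 1`, `|t| = |m₀₁|` (`hcoord_act_parabolic`).  Since
`σ(π)₀₁ = a² m₀₁ + a c (m₁₁ - σμ)` and `σ(π)₁₀ = -b² m₀₁ + b d (σμ - m₁₁)`, a bound on `|t|` bounds
the entries `π u`, `det π`, `π₀₁`, `π₁₀`, which determine `π`; by the discreteness of `σ(𝓞_K)`: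

* `finite_parabolic_of_hcoord_le` — **for every `R`, only finitely many `π ∈ Γ` fixing the cusp
  `u` move some point `H` of the cone with `|w_u(H)| ≤ R` to a point with `|w_u(π • H)| ≤ R`**.

This is the properly discontinuous action of the cusp stabiliser on the horosphere
([ElstrodtGrunewaldMennicke1998, Ch. 2 §2.3, Ch. 7 §7.3: `Γ_ζ` acts on the horosphere at `ζ` as
a discrete group of Euclidean motions]; [Swan1971, §3]).

## References

* J. Elstrodt, F. Grunewald, J. Mennicke, *Groups Acting on Hyperbolic Space* (1998), Ch. 2
  §2.3, Ch. 7 §7.3 [ElstrodtGrunewaldMennicke1998].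
* R. G. Swan, Adv. Math. 6 (1971), §3 [Swan1971].
-/

noncomputable section

open Matrix Complex NumberField
open scoped MatrixGroups ComplexConjugate

namespace Literature.NumberTheory.Automorphic

namespace BianchiCusp

open BianchiCone Literature.NumberTheory.NumberFields

variable {K : Type*} [Field K] [NumberField K] (σ : K →+* ℂ)

/-! ### The eigenvalue at a fixed cusp has absolute value one -/

/-- The eigenvalue of an element of `GL₂(𝓞_K)` fixing the cusp of `u`: if
`(π u)₀ u₁ = (π u)₁ u₀` then `π u = μ u` for some `μ ∈ K`. [folklore] -/
theorem exists_mulVec_eq_smul {u : OVec K} (hu : u ≠ 0) (M : Matrix (Fin 2) (Fin 2) (𝓞 K))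
    (h : (M *ᵥ u) 0 * u 1 - (M *ᵥ u) 1 * u 0 = 0) :
    ∃ μ : K, ∀ i, (((M *ᵥ u) i : 𝓞 K) : K) = μ * (u i : K) := by
  have h' : (((M *ᵥ u) 0 : 𝓞 K) : K) * (u 1 : K) = (((M *ᵥ u) 1 : 𝓞 K) : K) * (u 0 : K) := by
    have := congrArg (fun x : 𝓞 K => (x : K)) h
    simp only [map_sub, map_mul, map_zero] at this
    exact sub_eq_zero.1 this
  by_cases h0 : u 0 = 0
  · have h1 : u 1 ≠ 0 := by
      intro h1; apply hu; funext i; fin_cases i; exact h0; exact h1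
    have h1' : ((u 1 : 𝓞 K) : K) ≠ 0 := by
      rw [Ne, RingOfIntegers.coe_eq_algebraMap, map_eq_zero_iff _ (IsFractionRing.injective (𝓞 K) K)]
      exact h1
    have hu0 : ((u 0 : 𝓞 K) : K) = 0 := by rw [h0]; rfl
    have hA0 : (((M *ᵥ u) 0 : 𝓞 K) : K) = 0 := by
      rw [hu0, mul_zero] at h'
      exact (mul_eq_zero.1 h').resolve_right h1'
    refine ⟨(((M *ᵥ u) 1 : 𝓞 K) : K) / (u 1 : K), fun i => ?_⟩
    fin_cases i
    · change (((M *ᵥ u) 0 : 𝓞 K) : K) = _ * (u 0 : K)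
      rw [hA0, hu0, mul_zero]
    · change (((M *ᵥ u) 1 : 𝓞 K) : K) = _ * (u 1 : K)
      field_simp
  · have h0' : ((u 0 : 𝓞 K) : K) ≠ 0 := by
      rw [Ne, RingOfIntegers.coe_eq_algebraMap, map_eq_zero_iff _ (IsFractionRing.injective (𝓞 K) K)]
      exact h0
    refine ⟨(((M *ᵥ u) 0 : 𝓞 K) : K) / (u 0 : K), fun i => ?_⟩
    fin_cases i
    · change (((M *ᵥ u) 0 : 𝓞 K) : K) = _ * (u 0 : K)
      field_simp
    · change (((M *ᵥ u) 1 : 𝓞 K) : K) = _ * (u 1 : K)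
      rw [div_mul_eq_mul_div, eq_div_iff h0']
      linear_combination (-1 : K) * h'

/-- **The eigenvalue at a fixed cusp has absolute value `1`** under `σ`: `π u = μ u` with
`π ∈ GL₂(𝓞_K)` forces `|σμ| = 1` (write `μ = p/q`; `N𝔞_{q πu} = |Nq| N𝔞_u` and
`N𝔞_{p u} = |Np| N𝔞_u` with `𝔞_{πu} = 𝔞_u`). [cite: ElstrodtGrunewaldMennicke1998, Ch. 7 §7.3] -/
theorem norm_eq_one_of_mulVec_eq_smul [IsTotallyComplex K] (hK : Module.finrank ℚ K = 2)
    {u : OVec K} (hu : u ≠ 0) (π : GL (Fin 2) (𝓞 K)) {μ : K}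
    (h : ∀ i, ((((π : Matrix (Fin 2) (Fin 2) (𝓞 K)) *ᵥ u) i : 𝓞 K) : K) = μ * (u i : K)) : ‖σ μ‖ = 1 := by
  obtain ⟨p, q, hq, hpq⟩ := IsFractionRing.div_surjective (A := 𝓞 K) μ
  have hq0 : (q : 𝓞 K) ≠ 0 := nonZeroDivisors.ne_zero hq
  -- `q • (π u) = p • u`
  have hvec : q • ((π : Matrix (Fin 2) (Fin 2) (𝓞 K)) *ᵥ u) = p • u := by
    funext i
    apply IsFractionRing.injective (𝓞 K) K
    simp only [Pi.smul_apply, smul_eq_mul, map_mul]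
    rw [← RingOfIntegers.coe_eq_algebraMap, ← RingOfIntegers.coe_eq_algebraMap,
      ← RingOfIntegers.coe_eq_algebraMap, ← RingOfIntegers.coe_eq_algebraMap, h i, ← hpq]
    have hq' : ((algebraMap (𝓞 K) K) q) ≠ 0 := by
      rw [map_ne_zero_iff _ (IsFractionRing.injective (𝓞 K) K)]; exact hq0
    field_simp
  have hN := congrArg (fun v => Ideal.absNorm (idealOf v)) hvec
  simp only [absNorm_idealOf_smul, idealOf_mulVec] at hN
  have hNu : Ideal.absNorm (idealOf u) ≠ 0 := (absNorm_idealOf_pos hu).ne'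
  have hpq' : (Algebra.norm ℤ q).natAbs = (Algebra.norm ℤ p).natAbs := Nat.eq_of_mul_eq_mul_right
    (Nat.pos_of_ne_zero hNu) hN
  have hp0 : (p : 𝓞 K) ≠ 0 := by
    intro hp
    have hz : Algebra.norm ℤ (0 : 𝓞 K) = 0 := Algebra.norm_eq_zero_iff.2 rfl
    rw [hp, hz, Int.natAbs_zero, Int.natAbs_eq_zero, Algebra.norm_eq_zero_iff] at hpq'
    exact hq0 hpq'
  have hnp := ImaginaryQuadratic.norm_sq_eq_natAbs_norm hK σ p
  have hnq := ImaginaryQuadratic.norm_sq_eq_natAbs_norm hK σ q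
  rw [← hpq, map_div₀, norm_div, ← RingOfIntegers.coe_eq_algebraMap, ← RingOfIntegers.coe_eq_algebraMap]
  have hq1 : 0 < ‖σ (q : K)‖ := lt_of_lt_of_le one_pos (ImaginaryQuadratic.one_le_norm_of_ne_zero hK σ hq0)
  rw [div_eq_one_iff_eq hq1.ne']
  have h2 : ‖σ (p : K)‖ ^ 2 = ‖σ (q : K)‖ ^ 2 := by rw [hnp, hnq, hpq']
  have := norm_nonneg (σ (p : K))
  nlinarith [norm_nonneg (σ (q : K))]

/-! ### The conjugated element -/

section Parabolic

variable {u : OVec K} (hu : u ≠ 0)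

/-- `σ(π) = g_u m g_u⁻¹`. [folklore] -/
theorem toGL_eq_conj (π : GL (Fin 2) (𝓞 K)) :
    toGL σ π = cuspGL σ hu * conjElt σ hu π * (cuspGL σ hu)⁻¹ := by
  simp only [conjElt, ← mul_assoc, mul_inv_cancel, one_mul, mul_inv_cancel_right]

/-- The cusp form of `π • H` is `m • H_u`. [folklore] -/
theorem cuspForm_act (π : GL (Fin 2) (𝓞 K)) (H : Mat) :
    cuspForm σ hu (act (toGL σ π) H) = act (conjElt σ hu π) (cuspForm σ hu H) := by
  rw [cuspForm, cuspForm, ← act_mul, ← act_mul, conjElt, mul_assoc, mul_assoc, mul_inv_cancel, mul_one]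

/-- **`m` is upper triangular with corner `σμ`** when `π u = μ u`. [cite: ElstrodtGrunewaldMennicke1998, Ch. 7 §7.3] -/
theorem conjElt_mulVec_single (π : GL (Fin 2) (𝓞 K)) {μ : K}
    (h : ∀ i, ((((π : Matrix (Fin 2) (Fin 2) (𝓞 K)) *ᵥ u) i : 𝓞 K) : K) = μ * (u i : K)) :
    (conjElt σ hu π : Mat) *ᵥ Pi.single 0 1 = (σ μ) • (Pi.single 0 1 : Vec) := by
  have hemb : emb σ ((π : Matrix (Fin 2) (Fin 2) (𝓞 K)) *ᵥ u) = (σ μ) • emb σ u := by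
    funext i
    rw [emb_apply, Pi.smul_apply, emb_apply, smul_eq_mul, ← map_mul, ← h i]
  have hinv : ((cuspGL σ hu)⁻¹ : GL (Fin 2) ℂ) *ᵥ emb σ u = (Pi.single 0 1 : Vec) := by
    rw [← cuspGL_mulVec_single σ hu, mulVec_mulVec, coe_inv_mul, one_mulVec]
  rw [conjElt, Units.val_mul, Units.val_mul, ← mulVec_mulVec, ← mulVec_mulVec, cuspGL_mulVec_single,
    toGL_mulVec_emb, hemb, mulVec_smul, hinv]

/-- The entries of the first column of `m`. [folklore] -/
theorem conjElt_col_zero (π : GL (Fin 2) (𝓞 K)) {μ : K}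
    (h : ∀ i, ((((π : Matrix (Fin 2) (Fin 2) (𝓞 K)) *ᵥ u) i : 𝓞 K) : K) = μ * (u i : K)) :
    (conjElt σ hu π : Mat) 0 0 = σ μ ∧ (conjElt σ hu π : Mat) 1 0 = 0 := by
  have hv := conjElt_mulVec_single σ hu π h
  have h0 := congrFun hv 0
  have h1 := congrFun hv 1
  simp only [mulVec, dotProduct, Fin.sum_univ_two, Pi.single_apply, Pi.smul_apply, smul_eq_mul] at h0 h1
  simp at h0 h1
  exact ⟨h0, h1⟩

/-- `det m = σ(det π)`, of absolute value `1`. [folklore] -/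
theorem norm_det_conjElt [IsTotallyComplex K] (hK : Module.finrank ℚ K = 2) (π : GL (Fin 2) (𝓞 K)) :
    ‖(conjElt σ hu π : Mat).det‖ = 1 := by
  rw [conjElt, Units.val_mul, Units.val_mul, det_mul, det_mul, norm_mul, norm_mul, norm_det_toGL σ hK,
    mul_one, ← norm_mul, ← det_mul, coe_inv_mul, det_one, norm_one]

/-- **The diagonal entries of `m` have absolute value `1`.** [cite: ElstrodtGrunewaldMennicke1998, Ch. 7 §7.3] -/
theorem norm_conjElt_diag [IsTotallyComplex K] (hK : Module.finrank ℚ K = 2) (π : GL (Fin 2) (𝓞 K)) {μ : K}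
    (h : ∀ i, ((((π : Matrix (Fin 2) (Fin 2) (𝓞 K)) *ᵥ u) i : 𝓞 K) : K) = μ * (u i : K)) :
    ‖(conjElt σ hu π : Mat) 0 0‖ = 1 ∧ ‖(conjElt σ hu π : Mat) 1 1‖ = 1 := by
  obtain ⟨h00, h10⟩ := conjElt_col_zero σ hu π h
  have hn00 : ‖(conjElt σ hu π : Mat) 0 0‖ = 1 := by rw [h00]; exact norm_eq_one_of_mulVec_eq_smul σ hK hu π h
  refine ⟨hn00, ?_⟩
  have hd := norm_det_conjElt σ hu hK π
  rw [det_fin_two, h10, mul_zero, sub_zero, norm_mul, hn00, one_mul] at hd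
  exact hd

/-- The inverse of an upper triangular element of `GL₂(ℂ)`. [folklore] -/
theorem coe_inv_of_upper (m : GL (Fin 2) ℂ) (h10 : (m : Mat) 1 0 = 0) :
    ((m⁻¹ : GL (Fin 2) ℂ) : Mat) =
      !![((m : Mat) 0 0)⁻¹, -(m : Mat) 0 1 / ((m : Mat) 0 0 * (m : Mat) 1 1); 0, ((m : Mat) 1 1)⁻¹] := by
  have hdet : (m : Mat).det ≠ 0 := (Matrix.isUnits_det_units m).ne_zero
  rw [det_fin_two, h10, mul_zero, sub_zero] at hdet
  have h00 : (m : Mat) 0 0 ≠ 0 := left_ne_zero_of_mul hdet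
  have h11 : (m : Mat) 1 1 ≠ 0 := right_ne_zero_of_mul hdet
  apply Units.inv_eq_of_mul_eq_one_left
  ext i j
  fin_cases i <;> fin_cases j
  · simp [Matrix.mul_apply, Fin.sum_univ_two]
    rw [h10, mul_zero, add_zero, inv_mul_cancel₀ h00]
  · simp [Matrix.mul_apply, Fin.sum_univ_two]
    field_simp
    ring
  · simp [Matrix.mul_apply, Fin.sum_univ_two]
    exact Or.inr h10
  · simp [Matrix.mul_apply, Fin.sum_univ_two]
    exact inv_mul_cancel₀ h11

/-- **The horizontal ratio after an upper triangular motion**: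
`(m • M)₀₁ / (m • M)₀₀ = (m₀₀/m₁₁) · (M₀₁/M₀₀) - m₀₁/m₁₁`. [cite: ElstrodtGrunewaldMennicke1998, Ch. 2 §2.3] -/
theorem ratio_act_upper (m : GL (Fin 2) ℂ) (h10 : (m : Mat) 1 0 = 0) {M : Mat} (hM : M 0 0 ≠ 0) :
    act m M 0 1 / act m M 0 0 =
      (m : Mat) 0 0 / (m : Mat) 1 1 * (M 0 1 / M 0 0) - (m : Mat) 0 1 / (m : Mat) 1 1 := by
  have hdet : (m : Mat).det ≠ 0 := (Matrix.isUnits_det_units m).ne_zero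
  rw [det_fin_two, h10, mul_zero, sub_zero] at hdet
  have h00 : (m : Mat) 0 0 ≠ 0 := left_ne_zero_of_mul hdet
  have h11 : (m : Mat) 1 1 ≠ 0 := right_ne_zero_of_mul hdet
  have hc00 : (starRingEnd ℂ) ((m : Mat) 0 0) ≠ 0 := by rwa [map_ne_zero]
  have hc11 : (starRingEnd ℂ) ((m : Mat) 1 1) ≠ 0 := by rwa [map_ne_zero]
  rw [act, coe_inv_of_upper m h10]
  simp [Matrix.mul_apply, Fin.sum_univ_two, conjTranspose_apply]
  field_simp
  ring

/-- **The cusp stabiliser acts on the horizontal coordinate by Euclidean motions**: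
`w_u(π • H) = (m₀₀/m₁₁) w_u(H) - m₀₁/m₁₁`. [cite: ElstrodtGrunewaldMennicke1998, Ch. 7 §7.3] -/
theorem hcoord_act_parabolic (π : GL (Fin 2) (𝓞 K)) {μ : K}
    (h : ∀ i, ((((π : Matrix (Fin 2) (Fin 2) (𝓞 K)) *ᵥ u) i : 𝓞 K) : K) = μ * (u i : K)) {H : Mat} (hH : H ∈ cone) :
    hcoord σ hu (act (toGL σ π) H) =
      (conjElt σ hu π : Mat) 0 0 / (conjElt σ hu π : Mat) 1 1 * hcoord σ hu H -
        (conjElt σ hu π : Mat) 0 1 / (conjElt σ hu π : Mat) 1 1 := by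
  rw [hcoord, hcoord, cuspForm_act]
  exact ratio_act_upper _ (conjElt_col_zero σ hu π h).2 (cuspForm_zero_zero_ne_zero σ hu hH)

/-- **Bound on `m₀₁`** from bounds on the horizontal coordinates before and after. [folklore] -/
theorem norm_conjElt_zero_one_le [IsTotallyComplex K] (hK : Module.finrank ℚ K = 2) (π : GL (Fin 2) (𝓞 K)) {μ : K}
    (h : ∀ i, ((((π : Matrix (Fin 2) (Fin 2) (𝓞 K)) *ᵥ u) i : 𝓞 K) : K) = μ * (u i : K)) {H : Mat} (hH : H ∈ cone)
    {R : ℝ} (h1 : ‖hcoord σ hu H‖ ≤ R) (h2 : ‖hcoord σ hu (act (toGL σ π) H)‖ ≤ R) :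
    ‖(conjElt σ hu π : Mat) 0 1‖ ≤ 2 * R := by
  obtain ⟨hn00, hn11⟩ := norm_conjElt_diag σ hu hK π h
  have hf := hcoord_act_parabolic σ hu π h hH
  have h11 : (conjElt σ hu π : Mat) 1 1 ≠ 0 := by
    intro h0; rw [h0, norm_zero] at hn11; exact zero_ne_one hn11
  have he : (conjElt σ hu π : Mat) 0 1 =
      ((conjElt σ hu π : Mat) 0 0 / (conjElt σ hu π : Mat) 1 1 * hcoord σ hu H -
        hcoord σ hu (act (toGL σ π) H)) * (conjElt σ hu π : Mat) 1 1 := by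
    rw [hf]; field_simp; ring
  rw [he, norm_mul, hn11, mul_one]
  calc ‖(conjElt σ hu π : Mat) 0 0 / (conjElt σ hu π : Mat) 1 1 * hcoord σ hu H - hcoord σ hu (act (toGL σ π) H)‖
      ≤ ‖(conjElt σ hu π : Mat) 0 0 / (conjElt σ hu π : Mat) 1 1 * hcoord σ hu H‖ + ‖hcoord σ hu (act (toGL σ π) H)‖ :=
        norm_sub_le _ _
    _ ≤ R + R := by
        rw [norm_mul, norm_div, hn00, hn11, div_one, one_mul]
        exact add_le_add h1 h2
    _ = 2 * R := by ring

end Parabolic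

end BianchiCusp

end Literature.NumberTheory.Automorphic
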